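import Summits.HodgeConjecture.HodgeConjecture.Theorems.PadicSemiregularLiftHodgeFermatVarietiesPQClassification
import Summits.HodgeConjecture.HodgeConjecture.Theorems.PadicSemiregularLiftHodgeFermatVarietiesDoublingHodge
import HarnessLib

/-!
# Hodge `(p+1)`-tuples of level `pq`, VI: reachability and HC for the Fermat `(p-1)`-folds `X^{p-1}_{pq}` — line `cancel-by-any-claim-lattice`, crux `HodgeFermatVarieties` (stmt-HodgeConjecture-1334)

Pay-off file of the LEVEL-`pq` programme (primes `5 ≤ p`, `p + 2 < q`), stub S15 `stub_reachPQ` of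
skeleton generation 12, SUMMIT SIDE.

* `std_mem_supply_pq` — Aoki's standard multiset `σ_{p,a} = {a + i q : i < p} + {-p a}` of a UNIT `a` of
  `ℤ/pq` lies in the printed supply of level `pq` (fourth component with the prime `p` itself: `p ∣ pq`,
  `p ≠ 2`, `d = pq/p = q`, `(⟨a⟩, q) = 1`, so the side condition reads `q > 2`);
* `stub_reachPQ` (S15) — EVERY HODGE MULTISET OF `p + 1` ELEMENTS OF `ℤ/pq` IS ℤ-REACHABLE FROM THE PRINTED
  SUPPLY AT ITS OWN LEVEL: by the classification `PQ.stub_pqClassification` (S14) it is a sum of pairs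
  `{a, -a}` (`P :=` the pairs, `N := 0`; first component of the supply) or `σ_{p,a}` with `a` a unit
  (`P := {s}`, `N := 0`);
* `hodgeConjectureFor_pq` — **HC FOR THE FERMAT `(p-1)`-FOLDS OF DEGREE `pq`** (e.g. `X⁴₅₅`, `X⁶₇₇`,
  `X⁶₉₁`, `X¹⁰_{11·17}`), granted the named facts of S0 (Aoki 1987 Thm 1-4 (i),(ii), Thm 1-1, Thm 2-1;
  Aoki–Shioda 1983 (2.1)) and the statements of the stubs S2↑/S2↓ (claim along level raising), S3a
  (Shioda's semi-decomposable supply) and S5 (eigenspace structure) — exactly the hypotheses of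
  `Doubling.hodgeConjectureFor_two_mul_of_largePrimes_dim`, on which it is modelled: every Hodge character
  of `X^{p-1}_{pq}` has `p + 1` entries, so its value multiset is reachable at level `pq`, hence claimed
  (`Doubling.claimMultiset_of_stableReach`), and the per-dimension transfer
  `hodgeConjectureFor_of_claims_dim` applies. This is the first dimension in which Aoki's Thm A
  (`𝔅ⁿₘ = 𝔇ⁿₘ` iff every prime of `m` exceeds `n + 1`) does not cover the degree `pq`.

References: [Aoki1983] N. Aoki, Math. Ann. 266 (1983) Thm A′ (§7); [Aoki1987] N. Aoki, J. Math. Soc.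
Japan 39 (1987) §1 p. 387, Thm 1-4, Thm 2-1 (p. 388); [Shioda1979PJA] Proc. Japan Acad. 55A (1979) §2
Thm 1; [Ran1980] Compositio Math. 42 (1980) Prop. 1.7.
-/

set_option linter.dupNamespace false

noncomputable section

open Finset
open CategoryTheory AlgebraicGeometry
open Literature.AlgebraicGeometry Literature.AlgebraicGeometry.Motives Literature.AlgebraicTopology.SingularHomology
open Literature.AlgebraicGeometry.HodgeTheory Literature.AlgebraicGeometry.HodgeTheory.FermatCharacter
open Summit.HodgeConjecture.HodgeConjecture.Theorems.CancelByAnyClaimLattice.FiveQ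

namespace Summit.HodgeConjecture.HodgeConjecture.Theorems.CancelByAnyClaimLattice.PQ

/-- `Supply[M]` — the printed supply of level `M` (local notation of the line, verbatim). -/
local notation3 (prettyPrint := false) "Supply[" M "]" =>
  ({s : Multiset (ZMod M) | ∃ a : ZMod M, a ≠ 0 ∧ s = ({a, -a} : Multiset (ZMod M))} ∪
    {s : Multiset (ZMod M) | IsHodgeMultiset s ∧ Multiset.card s = 4} ∪
    {s : Multiset (ZMod M) | IsHodgeMultiset s ∧ IsSemiDecomposable s} ∪
    {s : Multiset (ZMod M) | ∃ (p : ℕ) (a : ZMod M), p.Prime ∧ p ≠ 2 ∧ p ∣ M ∧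
        2 < (M / p) / Nat.gcd (ZMod.val a) (M / p) ∧
        s = Multiset.map (fun j : ℕ => a + (j : ZMod M) * ((M / p : ℕ) : ZMod M)) (Multiset.range p) +
              {-((p : ZMod M) * a)}} : Set (Multiset (ZMod M)))

/-- `Reach[M, s]` (local notation of the line, verbatim). -/
local notation3 (prettyPrint := false) "Reach[" M ", " s "]" =>
  ∃ P N : Multiset (Multiset (ZMod M)),
    (∀ u ∈ P, u ∈ Supply[M]) ∧ (∀ u ∈ N, u ∈ Supply[M]) ∧ s + Multiset.sum N = Multiset.sum P

/-- `LevelRaise[k, m, s]` (local notation of the line, verbatim). -/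
local notation3 (prettyPrint := false) "LevelRaise[" k ", " m ", " s "]" =>
  Multiset.map (fun a : ZMod m => ((k * ZMod.val a : ℕ) : ZMod (k * m))) s

/-- `StableReach[m, s]` (local notation of the line, verbatim). -/
local notation3 (prettyPrint := false) "StableReach[" m ", " s "]" => ∃ k : ℕ, 0 < k ∧ Reach[k * m, LevelRaise[k, m, s]]

/-- The statement of stub S2↑ (pull-back of claim along level raising). Local notation only (verbatim
from `…DoublingHodge`). -/
local notation3 (prettyPrint := false) "LevelClaimPull" =>
  ∀ (m k r : ℕ) (α' : Fin (2 * r + 2) → ZMod m), 0 < k → (∀ i, α' i ≠ 0) →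
    FermatCharacter.Claim m r α' → FermatCharacter.Claim (k * m) r (fun i => ((k * (α' i).val : ℕ) : ZMod (k * m)))

/-- The statement of stub S2↓ (push-forward of claim along level raising). Local notation only. -/
local notation3 (prettyPrint := false) "LevelClaimPush" =>
  ∀ (m k r : ℕ) (α' : Fin (2 * r + 2) → ZMod m), 0 < k → (∀ i, α' i ≠ 0) →
    FermatCharacter.Claim (k * m) r (fun i => ((k * (α' i).val : ℕ) : ZMod (k * m))) → FermatCharacter.Claim m r α'

/-- The statement of stub S3a (Shioda's semi-decomposable supply is claimed). Local notation only. -/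
local notation3 (prettyPrint := false) "SemiClaim" =>
  ∀ (M : ℕ) [NeZero M] (s : Multiset (ZMod M)), IsHodgeMultiset s → IsSemiDecomposable s → ClaimMultiset M s

/-- The statement of stub S5 (eigenspace structure of `H²ᵖ(X²ᵖₘ)`, Ran Prop. 1.7) at every level.
Local notation only. -/
local notation3 (prettyPrint := false) "EigenStructure" =>
  ∀ (m : ℕ) [NeZero m] ⦃p : ℕ⦄, 0 < p →
    (∀ α : Fin (2 * p + 2) → ZMod m, α ≠ 0 → (∃ i, α i = 0) → fermatEigenspace m α (2 * p) = ⊥) ∧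
    (fermatEigenspace m (0 : Fin (2 * p + 2) → ZMod m) (2 * p) ≤
      LinearMap.range (complexBetti.map (SmoothHypersurface.hypersurfaceι (fermatPolynomial ℂ (2 * p) m)) (2 * p)).hom) ∧
    (∀ (A : HodgeModel (2 * p) (fermatHypersurface (2 * p) m)) (β : Fin (2 * p + 2) → ZMod m),
      (∀ i, β i ≠ 0) →
      (∃ x ∈ fermatEigenspace m β (2 * p), x ≠ 0 ∧ A.pullback (2 * p) x ∈ A.hodgePQ (2 * p) p p) →
        2 * FermatCharacter.normSum β = m * (2 * p + 2))

/-! ### §1 The standard element of a unit is in the printed supply -/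

/-- **`σ_{p,a}` of a unit `a` of `ℤ/pq` lies in the printed supply of level `pq`**: the fourth component
with the prime `p` itself (`p ∣ pq`, `p ≠ 2`), `d = pq/p = q` and `(⟨a⟩, q) = 1` (`a` is a unit mod `pq`),
so Aoki's side condition `d/(⟨a⟩, d) > 2` reads `q > 2`. [cite: Aoki1987, §1 p. 387 and Thm. 2-1 (p. 388)] -/
theorem std_mem_supply_pq {p q : ℕ} [Fact p.Prime] (hp : 5 ≤ p) (hpq' : p + 2 < q) {a : ZMod (p * q)}
    (ha : IsUnit a) :
    (Multiset.range p).map (fun i : ℕ ↦ a + (i : ZMod (p * q)) * ((p * q / p : ℕ) : ZMod (p * q))) +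
        {-((p : ZMod (p * q)) * a)} ∈ Supply[p * q] := by
  refine Or.inr ⟨p, a, Fact.out, by omega, dvd_mul_right p q, ?_, rfl⟩
  have hp0 : 0 < p := by omega
  rw [Nat.mul_div_cancel_left q hp0]
  have hcop : Nat.gcd a.val q = 1 := by
    have h := ZMod.val_coe_unit_coprime ha.unit
    rw [ha.unit_spec] at h
    exact Nat.Coprime.coprime_dvd_right (dvd_mul_left q p) h
  rw [hcop, Nat.div_one]
  omega

/-! ### §2 S15: reachability at the own level -/

/-- **S15 — EVERY HODGE `(p+1)`-TUPLE OF LEVEL `pq` IS REACHABLE AT ITS OWN LEVEL** (primes `5 ≤ p`,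
`p + 2 < q`): by the classification S14 it is a sum of pairs (`P :=` the pairs `{a, -a}`, `N := 0`) or
Aoki's standard element `σ_{p,a}` of a unit (`P := {s}`, `N := 0`, `std_mem_supply_pq`).
[cite: Aoki1983, Thm. A′ (§7)] [cite: Aoki1987, Thm. 2-1 (p. 388)] -/
theorem stub_reachPQ :
    ∀ (p q : ℕ) [Fact p.Prime] [Fact q.Prime], 5 ≤ p → p + 2 < q →
      ∀ s : Multiset (ZMod (p * q)), IsHodgeMultiset s → Multiset.card s = p + 1 → Reach[p * q, s] := by
  intro p q _ _ hp hpq' s hs hcard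
  rcases stub_pqClassification p q hp hpq' s hs hcard with ⟨Q, hQ0, hsQ⟩ | ⟨a, ha, hsa⟩
  · -- pairs: `P :=` the pairs `{a, -a}`, `N := 0`
    refine ⟨Q.map fun a ↦ ({a, -a} : Multiset (ZMod (p * q))), 0, fun u hu ↦ ?_,
      fun u hu ↦ absurd hu (Multiset.notMem_zero u), ?_⟩
    · obtain ⟨a, haQ, rfl⟩ := Multiset.mem_map.1 hu
      exact ReachPrimePow.pair_mem_supply (hQ0 a haQ)
    · rw [Multiset.sum_zero, add_zero, ReachOfLargePrimes.sum_map_pair]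
      exact hsQ
  · -- the standard element: `P := {s}`, `N := 0`
    refine ⟨{s}, 0, fun u hu ↦ ?_, fun u hu ↦ absurd hu (Multiset.notMem_zero u), ?_⟩
    · rw [Multiset.mem_singleton] at hu
      rw [hu, hsa]
      exact std_mem_supply_pq hp hpq' ha
    · rw [Multiset.sum_zero, add_zero, Multiset.sum_singleton]

/-! ### §3 The Hodge-conjecture pay-off: the Fermat `(p-1)`-folds of degree `pq` -/

/-- **HC FOR THE FERMAT `(p−1)`-FOLDS OF DEGREE `pq`** (primes `5 ≤ p`, `p + 2 < q`; e.g. `X⁴₅₅`, `X⁶₇₇`,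
`X⁶₉₁`, `X¹⁰_{11·17}`), granted the named facts of S0 and the statements of S2↑, S2↓, S3a and S5 at
`(pq, (p−1)/2)`: every Hodge character of `X^{p−1}_{pq}` has `p + 1` entries, so its value multiset is
reachable at level `pq` (S15 `stub_reachPQ`), hence claimed (`Doubling.claimMultiset_of_stableReach`), and
the per-dimension transfer `hodgeConjectureFor_of_claims_dim` applies. The first dimension in which Aoki's
Thm A (`𝔅 = 𝔇` iff all primes of `m` exceed `n + 1`) does not cover the degree `pq`.
[cite: Aoki1983, Thm. A′ (§7)] [cite: Aoki1987, Thm. 2-1 (p. 388)] -/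
theorem hodgeConjectureFor_pq
    (hJ : Aoki1987_claim_juxtaposition) (hC : Aoki1987_claim_of_claim_juxtaposition_paired)
    (hP : Shioda_claim_paired) (hNS : AokiShioda1983_eigenline_le_neronSeveri) (hS : Aoki1987_claim_pStandard)
    (hPull : LevelClaimPull) (hPush : LevelClaimPush) (h3a : SemiClaim) (h5 : EigenStructure)
    {p q : ℕ} [Fact p.Prime] [Fact q.Prime] (hp : 5 ≤ p) (hpq : p + 2 < q)
    ⦃X : SchemeOver ℂ⦄ (hF : IsFermatVariety (p - 1) (p * q) X) (hX : IsSmoothProjective (p - 1) X) :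
    HodgeConjectureFor (p - 1) X := by
  haveI : NeZero (p * q) := ⟨Nat.mul_ne_zero (Fact.out : p.Prime).ne_zero (Fact.out : q.Prime).ne_zero⟩
  obtain ⟨r, hr⟩ : ∃ r, p = 2 * r + 1 := (Fact.out : p.Prime).odd_of_ne_two (by omega)
  have hp1 : p - 1 = 2 * r := by omega
  rw [hp1] at hF hX ⊢
  have hr0 : 0 < r := by omega
  refine hodgeConjectureFor_of_claims_dim (m := p * q) (p := r) hr0 (h5 (p * q) hr0).1 (h5 (p * q) hr0).2.1
    (h5 (p * q) hr0).2.2 (fun α hα ↦ ?_) hF hX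
  have hs : IsHodgeMultiset (univ.val.map α) := hα.isHodgeMultiset
  have hcard : Multiset.card (univ.val.map α) = p + 1 := by rw [card_univ_val_map]; omega
  have hs0 : univ.val.map α ≠ 0 := fun h0 ↦ by
    have h := congrArg Multiset.card h0
    rw [hcard, Multiset.card_zero] at h
    omega
  have hR : Reach[p * q, univ.val.map α] := stub_reachPQ p q hp hpq _ hs hcard
  exact (claimMultiset_univ_val_map_iff α).1
    (Doubling.claimMultiset_of_stableReach hJ hC hP hNS hS hPull hPush h3a hs0 hs (Doubling.stableReach_of_reach hR))

end Summit.HodgeConjecture.HodgeConjecture.Theorems.CancelByAnyClaimLattice.PQ
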